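import Summits.AtomisticToContinuum.FouriersLaw.Theorems.LocalOhmBVLocalOhmStubSoftExtractionAux2
import Literature.MathematicalPhysics.KineticTheory.LangevinChainGibbs
import Summits.AtomisticToContinuum.FouriersLaw.Theorems.ParityLiouvilleSeedWindowLimitContinuity

/-!
# Level identities of the soft extraction (helper for `stub_softExtraction`)

Helper file for stub `stub_softExtraction` (S2c) of the birth line of crux `LocalOhmBV.LocalOhm`
(item stmt-AtomisticToContinuum-12009). For the normalised level functional
`Λ_k(F) = (ρ_k(F_k) - θ_k(x_k) · Cov_{Gibbs_N}(F_k, H_N)/T²) / g_k` (`F_k = F ∘ embed N x_k`,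
`g_k = d_k/(N-1)`, `ρ_k` the response `limUnder`) this file proves, at a single level:
LINEARITY in `F` on continuous polynomially bounded observables (`level_linear`), VANISHING on
transported Liouville derivatives of bulk cylinder functions (`level_liouville_eq_zero`: the response
quotient is identically zero by weak stationarity, the covariance vanishes), and UNIT CURRENT
(`level_current_eq_one`: the single-bond response is `g_k`, the covariance vanishes); and, along a
sequence of levels `N_k ≥ 3`, the eventual (in `k`) linearity `eventually_level_linear`.
-/

set_option autoImplicit false

noncomputable section

namespace Summit.AtomisticToContinuum.FouriersLaw.Theorems.LocalOhmBirth.SoftExtraction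

open MeasureTheory Filter Topology
open scoped BigOperators
open Literature.MathematicalPhysics.KineticTheory.HeatConduction
open Summit.AtomisticToContinuum.FouriersLaw.Theorems.WindowLimit (embed bondCurrentZ_embed)

/-! ### Linearity at a single level -/

/-- **Linearity of the level functional** on continuous polynomially bounded observables of the
`N`-chain (response limits exist and are linear; the covariance with `H_N` is linear). [folklore] -/
theorem level_linear (P : OscillatorChain) {N : ℕ} (μN : ℝ → ℝ → Measure (PhaseSpace N)) (T : ℝ)
    [IsProbabilityMeasure (μN T T)]
    (hresp : ∀ ψ : PhaseSpace N → ℝ, Continuous ψ →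
      (∃ (C₀ : ℝ) (m : ℕ), ∀ z, |ψ z| ≤ C₀ * (1 + ‖z‖) ^ m) →
      ∃ ρ : ℝ, Tendsto (fun δ : ℝ => ((∫ z, ψ z ∂(μN (T + δ / 2) (T - δ / 2))) -
        ∫ z, ψ z ∂(μN T T)) / δ) (𝓝[≠] 0) (𝓝 ρ))
    (hint : ∀ ψ : PhaseSpace N → ℝ, Continuous ψ →
      (∃ (C₀ : ℝ) (m : ℕ), ∀ z, |ψ z| ≤ C₀ * (1 + ‖z‖) ^ m) → Integrable ψ (μN T T))
    (hintG : ∀ ψ : PhaseSpace N → ℝ, Continuous ψ →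
      (∃ (C₀ : ℝ) (m : ℕ), ∀ z, |ψ z| ≤ C₀ * (1 + ‖z‖) ^ m) →
      Integrable ψ (P.gibbsMeasure N T) ∧
        Integrable (fun z => ψ z * P.hamiltonian N z) (P.gibbsMeasure N T))
    {ψ₁ ψ₂ : PhaseSpace N → ℝ} (hψ₁ : Continuous ψ₁) (hψ₂ : Continuous ψ₂)
    (hb₁ : ∃ (C₀ : ℝ) (m : ℕ), ∀ z, |ψ₁ z| ≤ C₀ * (1 + ‖z‖) ^ m)
    (hb₂ : ∃ (C₀ : ℝ) (m : ℕ), ∀ z, |ψ₂ z| ≤ C₀ * (1 + ‖z‖) ^ m) (c₁ c₂ θx g : ℝ) :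
    (limUnder (𝓝[≠] (0 : ℝ)) (fun δ : ℝ =>
          ((∫ z, (c₁ * ψ₁ z + c₂ * ψ₂ z) ∂(μN (T + δ / 2) (T - δ / 2))) -
            ∫ z, (c₁ * ψ₁ z + c₂ * ψ₂ z) ∂(μN T T)) / δ) -
        θx * (((∫ z, (c₁ * ψ₁ z + c₂ * ψ₂ z) * P.hamiltonian N z ∂(P.gibbsMeasure N T)) -
          (∫ z, (c₁ * ψ₁ z + c₂ * ψ₂ z) ∂(P.gibbsMeasure N T)) *
            (∫ z, P.hamiltonian N z ∂(P.gibbsMeasure N T))) / T ^ 2)) / g =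
      c₁ * ((limUnder (𝓝[≠] (0 : ℝ)) (fun δ : ℝ =>
          ((∫ z, ψ₁ z ∂(μN (T + δ / 2) (T - δ / 2))) - ∫ z, ψ₁ z ∂(μN T T)) / δ) -
        θx * (((∫ z, ψ₁ z * P.hamiltonian N z ∂(P.gibbsMeasure N T)) -
          (∫ z, ψ₁ z ∂(P.gibbsMeasure N T)) * (∫ z, P.hamiltonian N z ∂(P.gibbsMeasure N T))) /
            T ^ 2)) / g) +
      c₂ * ((limUnder (𝓝[≠] (0 : ℝ)) (fun δ : ℝ =>
          ((∫ z, ψ₂ z ∂(μN (T + δ / 2) (T - δ / 2))) - ∫ z, ψ₂ z ∂(μN T T)) / δ) -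
        θx * (((∫ z, ψ₂ z * P.hamiltonian N z ∂(P.gibbsMeasure N T)) -
          (∫ z, ψ₂ z ∂(P.gibbsMeasure N T)) * (∫ z, P.hamiltonian N z ∂(P.gibbsMeasure N T))) /
            T ^ 2)) / g) := by
  rw [limUnder_quotient_linear μN T hresp hint hψ₁ hψ₂ hb₁ hb₂ c₁ c₂]
  obtain ⟨hI₁, hI₁H⟩ := hintG ψ₁ hψ₁ hb₁
  obtain ⟨hI₂, hI₂H⟩ := hintG ψ₂ hψ₂ hb₂
  have e1 : ∫ z, (c₁ * ψ₁ z + c₂ * ψ₂ z) * P.hamiltonian N z ∂(P.gibbsMeasure N T) =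
      c₁ * ∫ z, ψ₁ z * P.hamiltonian N z ∂(P.gibbsMeasure N T) +
        c₂ * ∫ z, ψ₂ z * P.hamiltonian N z ∂(P.gibbsMeasure N T) := by
    have : ∀ z, (c₁ * ψ₁ z + c₂ * ψ₂ z) * P.hamiltonian N z =
        c₁ * (ψ₁ z * P.hamiltonian N z) + c₂ * (ψ₂ z * P.hamiltonian N z) := fun z => by ring
    simp_rw [this]
    rw [integral_add (hI₁H.const_mul c₁) (hI₂H.const_mul c₂), integral_const_mul,
      integral_const_mul]
  have e2 : ∫ z, (c₁ * ψ₁ z + c₂ * ψ₂ z) ∂(P.gibbsMeasure N T) =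
      c₁ * ∫ z, ψ₁ z ∂(P.gibbsMeasure N T) + c₂ * ∫ z, ψ₂ z ∂(P.gibbsMeasure N T) := by
    rw [integral_add (hI₁.const_mul c₁) (hI₂.const_mul c₂), integral_const_mul, integral_const_mul]
  rw [e1, e2]
  ring

/-! ### Invariance and unit current at a single level -/

/-- **The level functional vanishes on transported Liouville derivatives**: if the transported
observable `𝒜(G ∘ box) ∘ embed N c` has zero mean in every state of the family (weak stationarity
in the bulk) and zero covariance with `H_N` in the Gibbs state, its level value is `0`. [folklore] -/
theorem level_liouville_eq_zero (P : OscillatorChain) {N : ℕ} (μN : ℝ → ℝ → Measure (PhaseSpace N))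
    {T : ℝ} (hT : 0 < T) (θx g : ℝ) (a : ℤ) (n c : ℕ) (G : (Fin (n + 1) → ℝ × ℝ) → ℝ)
    (ha3 : ∀ T_L T_R : ℝ, 0 < T_L → 0 < T_R →
      ∫ z, liouvilleZ P (G ∘ boxRestrictAt a n) (embed N c z) ∂(μN T_L T_R) = 0)
    (hb2c : (∫ z, liouvilleZ P (G ∘ boxRestrictAt a n) (embed N c z) * P.hamiltonian N z
          ∂(P.gibbsMeasure N T)) -
        (∫ z, liouvilleZ P (G ∘ boxRestrictAt a n) (embed N c z) ∂(P.gibbsMeasure N T)) *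
          (∫ z, P.hamiltonian N z ∂(P.gibbsMeasure N T)) = 0) :
    (limUnder (𝓝[≠] (0 : ℝ)) (fun δ : ℝ =>
          ((∫ z, liouvilleZ P (G ∘ boxRestrictAt a n) (embed N c z) ∂(μN (T + δ / 2) (T - δ / 2))) -
            ∫ z, liouvilleZ P (G ∘ boxRestrictAt a n) (embed N c z) ∂(μN T T)) / δ) -
        θx * (((∫ z, liouvilleZ P (G ∘ boxRestrictAt a n) (embed N c z) * P.hamiltonian N z
            ∂(P.gibbsMeasure N T)) -
          (∫ z, liouvilleZ P (G ∘ boxRestrictAt a n) (embed N c z) ∂(P.gibbsMeasure N T)) *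
            (∫ z, P.hamiltonian N z ∂(P.gibbsMeasure N T))) / T ^ 2)) / g = 0 := by
  rw [limUnder_quotient_eq_zero μN hT (liouvilleZ P (G ∘ boxRestrictAt a n)) c ha3, hb2c]
  simp

/-- **Unit current at a single level**: for the bond `(i, i+1)` of `ℤ` read at finite sites
`j = i + c`, `j + 1` in the bulk, the level value of `σ ↦ j_i(σ)` is `1` (single-bond response
`d/(N-1)` over the normalisation `d/(N-1)`, zero covariance with `H_N`; the embedded bond current is
the finite-chain one, `WindowLimit.bondCurrentZ_embed`). [folklore] -/
theorem level_current_eq_one (P : OscillatorChain) {N : ℕ} (μN : ℝ → ℝ → Measure (PhaseSpace N))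
    {T : ℝ} (hT : 0 < T) (θx d : ℝ) (c : ℕ) (i : ℤ) (j : Fin N) (hj : (j : ℤ) = i + c)
    (hj2 : j.val + 2 ≤ N)
    (hD : Tendsto (fun δ : ℝ => P.totalCurrent (μN (T + δ / 2) (T - δ / 2)) / δ) (𝓝[≠] 0) (𝓝 d))
    (ha4 : ∀ (T_L T_R : ℝ), 0 < T_L → 0 < T_R → ∀ i k : Fin N, i.val + 2 ≤ N → k.val + 2 ≤ N →
      ∫ z, P.bondCurrent N i z ∂(μN T_L T_R) = ∫ z, P.bondCurrent N k z ∂(μN T_L T_R))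
    (hG0 : ∫ z, P.bondCurrent N j z ∂(μN T T) = 0)
    (hb2b : (∫ z, P.bondCurrent N j z * P.hamiltonian N z ∂(P.gibbsMeasure N T)) -
        (∫ z, P.bondCurrent N j z ∂(P.gibbsMeasure N T)) *
          (∫ z, P.hamiltonian N z ∂(P.gibbsMeasure N T)) = 0)
    (hd : d ≠ 0) :
    (limUnder (𝓝[≠] (0 : ℝ)) (fun δ : ℝ =>
          ((∫ z, P.bondCurrentZ (embed N c z) i ∂(μN (T + δ / 2) (T - δ / 2))) -
            ∫ z, P.bondCurrentZ (embed N c z) i ∂(μN T T)) / δ) -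
        θx * (((∫ z, P.bondCurrentZ (embed N c z) i * P.hamiltonian N z ∂(P.gibbsMeasure N T)) -
          (∫ z, P.bondCurrentZ (embed N c z) i ∂(P.gibbsMeasure N T)) *
            (∫ z, P.hamiltonian N z ∂(P.gibbsMeasure N T))) / T ^ 2)) / (d / ((N : ℝ) - 1)) =
      1 := by
  obtain rfl : i = (j : ℤ) - c := by omega
  simp_rw [bondCurrentZ_embed P N c _ j (by omega)]
  rw [(tendsto_quotient_bondCurrent P μN T d hT j hj2 hD ha4 hG0).limUnder_eq, hb2b]
  have hN1 : (N : ℝ) - 1 ≠ 0 := by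
    have : (2 : ℝ) ≤ N := by exact_mod_cast (by omega : 2 ≤ N)
    linarith
  rw [zero_div, mul_zero, sub_zero, div_self (div_ne_zero hd hN1)]

/-! ### Eventual linearity along the violating sequence -/

/-- **Eventual linearity of the level functionals** `Λ_k` on box observables, along a sequence of
levels `N_k ≥ 3` (so that the finite-`N` package applies). [folklore] -/
theorem eventually_level_linear :
    ∀ (P : OscillatorChain) (μ : (N : ℕ) → ℝ → ℝ → Measure (PhaseSpace N)) (T : ℝ),
    (∀ N : ℕ, IsProbabilityMeasure (P.gibbsMeasure N T)) →
    (∀ N : ℕ, 3 ≤ N → μ N T T = P.gibbsMeasure N T) →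
    (∀ N : ℕ, 3 ≤ N → ∀ ψ : PhaseSpace N → ℝ, Continuous ψ →
        (∃ (C₀ : ℝ) (m : ℕ), ∀ z, |ψ z| ≤ C₀ * (1 + ‖z‖) ^ m) →
        ∃ ρ : ℝ, Tendsto (fun δ : ℝ => ((∫ z, ψ z ∂(μ N (T + δ / 2) (T - δ / 2))) -
          ∫ z, ψ z ∂(μ N T T)) / δ) (𝓝[≠] 0) (𝓝 ρ)) →
    (∀ (N : ℕ) (ψ : PhaseSpace N → ℝ), Continuous ψ →
      (∃ (C₀ : ℝ) (m : ℕ), ∀ z, |ψ z| ≤ C₀ * (1 + ‖z‖) ^ m) →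
      Integrable ψ (P.gibbsMeasure N T) ∧
        Integrable (fun z => ψ z * P.hamiltonian N z) (P.gibbsMeasure N T)) →
    ∀ (Nk : ℕ → ℕ) (dk : ℕ → ℝ) (θk : (k : ℕ) → Fin (Nk k) → ℝ) (xk : ℕ → ℕ),
    (∀ k : ℕ, xk k + k + 2 ≤ Nk k) →
    ∀ (a : ℤ) (n : ℕ) (c₁ c₂ : ℝ) (g₁ g₂ : (Fin (n + 1) → ℝ × ℝ) → ℝ), Continuous g₁ →
    Continuous g₂ → (∃ (C₀ : ℝ) (m : ℕ), ∀ y, |g₁ y| ≤ C₀ * (1 + ‖y‖) ^ m) →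
    (∃ (C₀ : ℝ) (m : ℕ), ∀ y, |g₂ y| ≤ C₀ * (1 + ‖y‖) ^ m) →
    ∀ᶠ k in atTop,
      (limUnder (𝓝[≠] (0 : ℝ)) (fun δ : ℝ =>
            ((∫ z, (c₁ * g₁ (boxRestrictAt a n (embed (Nk k) (xk k) z)) +
                c₂ * g₂ (boxRestrictAt a n (embed (Nk k) (xk k) z)))
                ∂(μ (Nk k) (T + δ / 2) (T - δ / 2))) -
              ∫ z, (c₁ * g₁ (boxRestrictAt a n (embed (Nk k) (xk k) z)) +
                c₂ * g₂ (boxRestrictAt a n (embed (Nk k) (xk k) z))) ∂(μ (Nk k) T T)) / δ) -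
          (∑ i : Fin (Nk k), if i.val = xk k then θk k i else 0) *
            (((∫ z, (c₁ * g₁ (boxRestrictAt a n (embed (Nk k) (xk k) z)) +
                c₂ * g₂ (boxRestrictAt a n (embed (Nk k) (xk k) z))) * P.hamiltonian (Nk k) z
                ∂(P.gibbsMeasure (Nk k) T)) -
              (∫ z, (c₁ * g₁ (boxRestrictAt a n (embed (Nk k) (xk k) z)) +
                c₂ * g₂ (boxRestrictAt a n (embed (Nk k) (xk k) z))) ∂(P.gibbsMeasure (Nk k) T)) *
                (∫ z, P.hamiltonian (Nk k) z ∂(P.gibbsMeasure (Nk k) T))) / T ^ 2)) /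
          (dk k / ((Nk k : ℝ) - 1)) =
        c₁ * ((limUnder (𝓝[≠] (0 : ℝ)) (fun δ : ℝ =>
            ((∫ z, g₁ (boxRestrictAt a n (embed (Nk k) (xk k) z)) ∂(μ (Nk k) (T + δ / 2) (T - δ / 2))) -
              ∫ z, g₁ (boxRestrictAt a n (embed (Nk k) (xk k) z)) ∂(μ (Nk k) T T)) / δ) -
          (∑ i : Fin (Nk k), if i.val = xk k then θk k i else 0) *
            (((∫ z, g₁ (boxRestrictAt a n (embed (Nk k) (xk k) z)) * P.hamiltonian (Nk k) z
                ∂(P.gibbsMeasure (Nk k) T)) -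
              (∫ z, g₁ (boxRestrictAt a n (embed (Nk k) (xk k) z)) ∂(P.gibbsMeasure (Nk k) T)) *
                (∫ z, P.hamiltonian (Nk k) z ∂(P.gibbsMeasure (Nk k) T))) / T ^ 2)) /
          (dk k / ((Nk k : ℝ) - 1))) +
        c₂ * ((limUnder (𝓝[≠] (0 : ℝ)) (fun δ : ℝ =>
            ((∫ z, g₂ (boxRestrictAt a n (embed (Nk k) (xk k) z)) ∂(μ (Nk k) (T + δ / 2) (T - δ / 2))) -
              ∫ z, g₂ (boxRestrictAt a n (embed (Nk k) (xk k) z)) ∂(μ (Nk k) T T)) / δ) -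
          (∑ i : Fin (Nk k), if i.val = xk k then θk k i else 0) *
            (((∫ z, g₂ (boxRestrictAt a n (embed (Nk k) (xk k) z)) * P.hamiltonian (Nk k) z
                ∂(P.gibbsMeasure (Nk k) T)) -
              (∫ z, g₂ (boxRestrictAt a n (embed (Nk k) (xk k) z)) ∂(P.gibbsMeasure (Nk k) T)) *
                (∫ z, P.hamiltonian (Nk k) z ∂(P.gibbsMeasure (Nk k) T))) / T ^ 2)) /
          (dk k / ((Nk k : ℝ) - 1))) := by
  intro P μ T hGprob ha1 ha2 hb1 Nk dk θk xk hx₂ a n c₁ c₂ g₁ g₂ hg₁ hg₂ hgb₁ hgb₂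
  filter_upwards [eventually_ge_atTop 1] with k hk
  have hN3 : 3 ≤ Nk k := by have := hx₂ k; omega
  haveI : IsProbabilityMeasure (μ (Nk k) T T) := by rw [ha1 _ hN3]; exact hGprob _
  have hint : ∀ ψ : PhaseSpace (Nk k) → ℝ, Continuous ψ →
      (∃ (C₀ : ℝ) (m : ℕ), ∀ z, |ψ z| ≤ C₀ * (1 + ‖z‖) ^ m) → Integrable ψ (μ (Nk k) T T) :=
    fun ψ hψ hb => by rw [ha1 _ hN3]; exact (hb1 (Nk k) ψ hψ hb).1
  obtain ⟨C₁, m₁, hC₁⟩ := hgb₁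
  obtain ⟨C₂, m₂, hC₂⟩ := hgb₂
  exact level_linear P (μ (Nk k)) T (ha2 _ hN3) hint (hb1 (Nk k))
    (continuous_comp_boxRestrictAt_embed a n hg₁) (continuous_comp_boxRestrictAt_embed a n hg₂)
    ⟨C₁, m₁, fun z => polyBound_comp_boxRestrictAt_embed a n hC₁ z⟩
    ⟨C₂, m₂, fun z => polyBound_comp_boxRestrictAt_embed a n hC₂ z⟩ c₁ c₂ _ _

end Summit.AtomisticToContinuum.FouriersLaw.Theorems.LocalOhmBirth.SoftExtraction

end
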